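import Literature.NumberTheory.Automorphic.SmoothInductionFrobeniusNaturality   -- ★ p852974 (F0P3a-p03 (g28)) FN: `frobeniusNormalized_{apply_mk,comp_toLinearMap,comp_of_pointwise,symm_apply,symm_comp}`
import Literature.NumberTheory.Automorphic.JacquetNonzeroEmbedsNormalizedInd     -- ★ `deltaChar_cmBorelTriple_eq_one_of_mem_N` (the `hδ` of the CM Borel, every `N`, every finite `v`); brings ★ `UnitaryGroupBorelInduction` (`cmBorelTriple`, `cmPrincipalSeries`, `locallyCompactSpace_cmBorelU`)
import Literature.NumberTheory.Automorphic.IntertwiningMapTransport            -- ★ p853067 (F0P3b-p01 (g24), E1 row 20; ED. 2 §3 here): `exists_frobeniusNormalized_symm_comp` (the bundled normalised Jacquet map `g` with `g.toLinearMap = jacquetMap t f`)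
import HarnessLib

/-!
# Frobenius naturality AT THE CM DATUM: `Hom_G(π, i_B σ) ≃ Hom_T(r_B π, σ)` for `G = U(Φ_N)(L⁺_v)`, `B = TN = cmBorelTriple L N v`, natural in BOTH variables —
# «the adjoint of `T ∘ b` is `adj(T) ∘ r_B(b)`» (S7) and «the adjoint of `S ∘ φ` is `u ∘ adj(φ)`» (S8), with `δ_B|_N = 1` discharged

Cell `pub/hodgecm-mathlib`, crux H413 = `stmt-HodgeConjecture-24833` (`--supports` lane, helper, THEOREMS ONLY: no definition ∕ instance ∕ notation ∕ named fact ∕ `sorry`).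
Namespace `Summit.HodgeConjecture.HodgeConjecture.Cruxes.H413.F0P3cStCharTSFrobeniusNaturality`.  E1 BRICK LEDGER (F0P3a-p03 (g28)) row 19 «FN @ DATUM», dealt 2026-09-02
23:21Z to F0P2-p02 (g25) under LEAD T15-05 (w3) «GO-LOW»: the ORGAN-SIDE DRESSING of ★ `SmoothInductionFrobeniusNaturality` (p852974, generic, `namespace Representation`) at the
parabolic triple `t := cmBorelTriple L N v` of the tree's CM datum — the Borel `B = TN` of `G = U(Φ_N)(L⁺_v) = ↥(unitaryGroupOfForm (conjLocal L c v) (cmLocalForm L N v))`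
(= ★ `Rogawski1990.Gqs L v` at `N = 3`, reducibly), `T = torusU`, `hδ : δ_B|_N = 1` DISCHARGED by ★ `deltaChar_cmBorelTriple_eq_one_of_mem_N`; the (Prop-valued) instance binder `[LocallyCompactSpace ↥B(L⁺_v)]` of the heads is
discharged at any use site by ★ `locallyCompactSpace_cmBorelU L N v` (`haveI`), exactly as ★ `cmPrincipalSeries` does internally (proof-irrelevant, so the two agree definitionally)
— so every head below is a 1-line specialisation and carries only the honest binders (`hπ : π.IsSmooth`, the maps).  Seat F0P2-p02 (g25).
CONSUMER-IN-WAITING: the K4′ Ext-free spine (MEMO «K4′ SPINE WITHOUT Ext» v2 0160dcb7, F0P2-p02 (g24)), steps S7 («`ψ = adj(φ̄) ∘ r_B(b)` has rank ≤ 1») and S8 («the adjoint of `q ∘ φ` is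
`p_N ∘ ψ`») around the reducible principal series `I = i_B θ̃ = π⁺ ⊕ π⁻` and `Ĩ = i_B N` (`N` the non-split self-extension of `θ̃`) — there `σ` is the 2-dimensional `N`, NOT a character,
which is why §1 is stated for an ARBITRARY `σ : Representation ℂ T W`; §2 records that the character case `i_B χ = ★ cmPrincipalSeries L N v χ` is DEFINITIONALLY `normalizedInd (cmBorelTriple L N v)
((trivial ℂ T ℂ).twist χ)` (★ `UnitaryGroupBorelInduction`), so §1 covers it.  HONEST LABEL: count-neutral generic-at-datum helper (identities of maps; nothing printed is asserted; the K4′ rider is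
NOT NOW alone, T15-05 (w3)); h413 OPEN; HC_CM is proved only modulo the 7 printed citations (2 remaining named inputs hLiu418 = stmt-HodgeConjecture-24832, h413 =
stmt-HodgeConjecture-24833) until rung 0 closes.

NOTATION in the heads (no `def`): `E_σ(π) := (frobeniusEquiv hπ).trans (normalizedJacquetHomEquiv (cmBorelTriple L N v) π σ hδ) : Hom_G(π, i_B σ) ≃ₗ Hom_T(r_B π, σ)` written out in full,
`hδ := deltaChar_cmBorelTriple_eq_one_of_mem_N L N v`, `r_B(f) := jacquetMap (cmBorelTriple L N v) f`.
* §1 (any `σ`): `frobeniusNormalized_cmBorel_apply_mk` (`E(T)[v] = (T v)(1)`), **`frobeniusNormalized_cmBorel_comp_toLinearMap`** (S7: `E(T ∘ f) = E(T) ∘ r_B(f)`),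
  **`frobeniusNormalized_cmBorel_comp_of_pointwise`** (S8: `E₂(S ∘ T) = u ∘ E(T)` for `S : i_B σ → i_B σ₂` over `u : σ → σ₂` pointwise), `frobeniusNormalized_cmBorel_symm_apply`,
  `frobeniusNormalized_cmBorel_symm_comp` (the inverse is natural in the `G`-variable: `E′⁻¹(ψ ∘ r_B f) = E⁻¹(ψ) ∘ f`).
* §2 (characters): the `rfl` BRIDGE `cmPrincipalSeries_eq_normalizedInd : cmPrincipalSeries L N v χ = normalizedInd (cmBorelTriple L N v) ((trivial ℂ T ℂ).twist χ)` — so §1 serves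
  `i_B χ = ★ cmPrincipalSeries L N v χ` after a `rfl` retyping of `T` (feeding a `cmPrincipalSeries`-typed `T` straight into `frobeniusEquiv` costs > 200 000 heartbeats of `whnf`, measured).

## References
* [BernsteinZelevinsky1977] I. N. Bernstein, A. V. Zelevinsky, *Induced representations of reductive p-adic groups I*, Ann. Sci. ÉNS 10 (1977), §1.8–1.9, Prop. 1.9 (b) p. 445.
* [Casselman1995] W. Casselman, *Introduction to the theory of admissible representations of p-adic reductive groups* (1995), §3.2 (Frobenius reciprocity, Thm. 3.2.4).
* [Rogawski1990] J. D. Rogawski, *Automorphic Representations of Unitary Groups in Three Variables*, Ann. of Math. Stud. 123 (1990), §12.2 p. 173 (the principal series of `U(3)`).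
-/

set_option autoImplicit false

set_option linter.dupNamespace false

noncomputable section

open NumberField IsDedekindDomain

namespace Summit.HodgeConjecture.HodgeConjecture.Cruxes.H413.F0P3cStCharTSFrobeniusNaturality

open Literature.NumberTheory.Automorphic Literature.NumberTheory.Automorphic.UnitaryGroup Representation

variable (L : Type) [Field L] [NumberField L] [IsCMField L] (N : ℕ) (v : HeightOneSpectrum (𝓞 ↥(maximalRealSubfield L)))

/-! ## §1 Any `σ : Representation ℂ T W` — the normalised Frobenius equivalence over the CM Borel `cmBorelTriple L N v`, `hδ` discharged -/

section AnySigma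

variable [LocallyCompactSpace ↥(borelU (conjLocal L (IsCMField.complexConj L) v) (cmLocalForm L N v))]
  {V V' W W₂ : Type*} [AddCommGroup V] [Module ℂ V] [AddCommGroup V'] [Module ℂ V']
  [AddCommGroup W] [Module ℂ W] [AddCommGroup W₂] [Module ℂ W₂]
  {π : Representation ℂ ↥(unitaryGroupOfForm (conjLocal L (IsCMField.complexConj L) v) (cmLocalForm L N v)) V}
  {π' : Representation ℂ ↥(unitaryGroupOfForm (conjLocal L (IsCMField.complexConj L) v) (cmLocalForm L N v)) V'}
  (σ : Representation ℂ ↥(cmBorelTriple L N v).M W) (σ₂ : Representation ℂ ↥(cmBorelTriple L N v).M W₂)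

/-- **`E(T)[v] = (T v)(1)` at the CM datum**: the normalised Frobenius equivalence `Hom_G(π, i_B σ) ≃ Hom_T(r_B π, σ)` over `B = cmBorelTriple L N v` is evaluation at `1` on the Jacquet
module (★ `frobeniusNormalized_apply_mk`, `hδ` = ★ `deltaChar_cmBorelTriple_eq_one_of_mem_N`). [cite: BernsteinZelevinsky1977, Proposition 1.9(b), p. 445] [cite: Rogawski1990, §12.2 p. 173] -/
theorem frobeniusNormalized_cmBorel_apply_mk (hπ : π.IsSmooth)
    (T : π.IntertwiningMap (Representation.normalizedInd (cmBorelTriple L N v) σ)) (w : V) :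
    ((frobeniusEquiv (H := (cmBorelTriple L N v).P) (σ := Representation.twist (σ.comp (cmBorelTriple L N v).proj) (rootDeltaChar (cmBorelTriple L N v).P)) hπ).trans
        (normalizedJacquetHomEquiv (cmBorelTriple L N v) π σ (deltaChar_cmBorelTriple_eq_one_of_mem_N L N v))) T
          (Coinvariants.mk ((cmBorelTriple L N v).restrict π) w) = (T w).toFun 1 :=
  rfl

/-- **S7 AT THE DATUM — naturality in the `G`-variable** («the adjoint of `T ∘ f` is `adj(T) ∘ r_B(f)`»): for `G = U(Φ_N)(L⁺_v)`, `B = cmBorelTriple L N v`, a `G`-map `f : π′ → π` of smooth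
representations and `T : π → i_B σ`, `E′(T ∘ f) = E(T) ∘ r_B(f)` on underlying linear maps (`r_B(f) = jacquetMap (cmBorelTriple L N v) f`, `[w] ↦ [f w]`).  ★ `frobeniusNormalized_comp_toLinearMap`
with `hδ` discharged; the K4′ spine's S7 reads it with `σ = N`, `T = φ̄`, `f = b`. [cite: BernsteinZelevinsky1977, Proposition 1.9(b), p. 445] [cite: Casselman1995, §3.2] -/
theorem frobeniusNormalized_cmBorel_comp_toLinearMap (hπ : π.IsSmooth) (hπ' : π'.IsSmooth) (f : π'.IntertwiningMap π)
    (T : π.IntertwiningMap (Representation.normalizedInd (cmBorelTriple L N v) σ)) :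
    (((frobeniusEquiv (H := (cmBorelTriple L N v).P) (σ := Representation.twist (σ.comp (cmBorelTriple L N v).proj) (rootDeltaChar (cmBorelTriple L N v).P)) hπ').trans
        (normalizedJacquetHomEquiv (cmBorelTriple L N v) π' σ (deltaChar_cmBorelTriple_eq_one_of_mem_N L N v))) (T.comp f)).toLinearMap =
      (((frobeniusEquiv (H := (cmBorelTriple L N v).P) (σ := Representation.twist (σ.comp (cmBorelTriple L N v).proj) (rootDeltaChar (cmBorelTriple L N v).P)) hπ).trans
        (normalizedJacquetHomEquiv (cmBorelTriple L N v) π σ (deltaChar_cmBorelTriple_eq_one_of_mem_N L N v))) T).toLinearMap ∘ₗ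
        (jacquetMap (cmBorelTriple L N v) f).toLinearMap :=
  frobeniusNormalized_comp_toLinearMap (cmBorelTriple L N v) σ hπ hπ' (deltaChar_cmBorelTriple_eq_one_of_mem_N L N v) f T

/-- **S8 AT THE DATUM — naturality in the `T`-variable** («the adjoint of `S ∘ T` is `u ∘ adj(T)`»): for `T : π → i_B σ`, a `T(L⁺_v)`-map `u : σ → σ₂` and ANY `G`-map `S : i_B σ → i_B σ₂`
lying over `u` pointwise (`(S F)(x) = u (F x)`, e.g. `i_B(u)`; the K4′ spine's S8 reads it with `σ = N`, `σ₂ = θ̃`, `u = p_N`, `S = q : Ĩ → I_quot`), `E₂(S ∘ T) = u ∘ E(T)`.  ★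
`frobeniusNormalized_comp_of_pointwise` with `hδ` discharged. [cite: BernsteinZelevinsky1977, §1.8] [cite: Casselman1995, §3.2] -/
theorem frobeniusNormalized_cmBorel_comp_of_pointwise (hπ : π.IsSmooth)
    (T : π.IntertwiningMap (Representation.normalizedInd (cmBorelTriple L N v) σ))
    (S : (Representation.normalizedInd (cmBorelTriple L N v) σ).IntertwiningMap (Representation.normalizedInd (cmBorelTriple L N v) σ₂))
    (u : σ.IntertwiningMap σ₂)
    (hS : ∀ (F : SmoothInd (cmBorelTriple L N v).P (Representation.twist (σ.comp (cmBorelTriple L N v).proj) (rootDeltaChar (cmBorelTriple L N v).P)))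
        (x : ↥(unitaryGroupOfForm (conjLocal L (IsCMField.complexConj L) v) (cmLocalForm L N v))), (S F).toFun x = u (F.toFun x)) :
    ((frobeniusEquiv (H := (cmBorelTriple L N v).P) (σ := Representation.twist (σ₂.comp (cmBorelTriple L N v).proj) (rootDeltaChar (cmBorelTriple L N v).P)) hπ).trans
        (normalizedJacquetHomEquiv (cmBorelTriple L N v) π σ₂ (deltaChar_cmBorelTriple_eq_one_of_mem_N L N v))) (S.comp T) =
      u.comp (((frobeniusEquiv (H := (cmBorelTriple L N v).P) (σ := Representation.twist (σ.comp (cmBorelTriple L N v).proj) (rootDeltaChar (cmBorelTriple L N v).P)) hπ).trans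
        (normalizedJacquetHomEquiv (cmBorelTriple L N v) π σ (deltaChar_cmBorelTriple_eq_one_of_mem_N L N v))) T) :=
  frobeniusNormalized_comp_of_pointwise (cmBorelTriple L N v) σ σ₂ hπ (deltaChar_cmBorelTriple_eq_one_of_mem_N L N v) T S u hS

/-- **The inverse at the datum**: `(E⁻¹ ψ w)(g) = ψ [π g w]` (★ `frobeniusNormalized_symm_apply`). [cite: BernsteinZelevinsky1977, Proposition 1.9(b), p. 445] -/
theorem frobeniusNormalized_cmBorel_symm_apply (hπ : π.IsSmooth)
    (ψ : (π.normalizedJacquet (cmBorelTriple L N v)).IntertwiningMap σ) (w : V)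
    (g : ↥(unitaryGroupOfForm (conjLocal L (IsCMField.complexConj L) v) (cmLocalForm L N v))) :
    ((((frobeniusEquiv (H := (cmBorelTriple L N v).P) (σ := Representation.twist (σ.comp (cmBorelTriple L N v).proj) (rootDeltaChar (cmBorelTriple L N v).P)) hπ).trans
        (normalizedJacquetHomEquiv (cmBorelTriple L N v) π σ (deltaChar_cmBorelTriple_eq_one_of_mem_N L N v))).symm ψ) w).toFun g =
      ψ (Coinvariants.mk ((cmBorelTriple L N v).restrict π) (π g w)) :=
  rfl

/-- **Naturality of the inverse in the `G`-variable at the datum**: for `f : π′ → π`, `ψ : r_B π → σ` and any `ψ′ : r_B π′ → σ` that IS `ψ ∘ r_B(f)` on underlying linear maps,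
`E′⁻¹(ψ′) = E⁻¹(ψ) ∘ f` (★ `frobeniusNormalized_symm_comp`). [cite: BernsteinZelevinsky1977, Proposition 1.9(b), p. 445] [cite: Casselman1995, §3.2] -/
theorem frobeniusNormalized_cmBorel_symm_comp (hπ : π.IsSmooth) (hπ' : π'.IsSmooth) (f : π'.IntertwiningMap π)
    (ψ : (π.normalizedJacquet (cmBorelTriple L N v)).IntertwiningMap σ)
    (ψ' : (π'.normalizedJacquet (cmBorelTriple L N v)).IntertwiningMap σ)
    (hψ : ψ'.toLinearMap = ψ.toLinearMap ∘ₗ (jacquetMap (cmBorelTriple L N v) f).toLinearMap) :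
    ((frobeniusEquiv (H := (cmBorelTriple L N v).P) (σ := Representation.twist (σ.comp (cmBorelTriple L N v).proj) (rootDeltaChar (cmBorelTriple L N v).P)) hπ').trans
        (normalizedJacquetHomEquiv (cmBorelTriple L N v) π' σ (deltaChar_cmBorelTriple_eq_one_of_mem_N L N v))).symm ψ' =
      (((frobeniusEquiv (H := (cmBorelTriple L N v).P) (σ := Representation.twist (σ.comp (cmBorelTriple L N v).proj) (rootDeltaChar (cmBorelTriple L N v).P)) hπ).trans
        (normalizedJacquetHomEquiv (cmBorelTriple L N v) π σ (deltaChar_cmBorelTriple_eq_one_of_mem_N L N v))).symm ψ).comp f :=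
  frobeniusNormalized_symm_comp (cmBorelTriple L N v) σ hπ hπ' (deltaChar_cmBorelTriple_eq_one_of_mem_N L N v) f ψ ψ' hψ

end AnySigma

/-! ## §2 Characters: the bridge `cmPrincipalSeries L N v χ = normalizedInd (cmBorelTriple L N v) ((trivial ℂ T ℂ).twist χ)` (by `rfl`) -/

section Character

variable (χ : ↥(torusU (conjLocal L (IsCMField.complexConj L) v) (cmLocalForm L N v)) →* ℂˣ)

/-- **BRIDGE: the principal series `i_G(χ) = cmPrincipalSeries L N v χ` IS `normalizedInd (cmBorelTriple L N v) ((trivial ℂ T ℂ).twist χ)`** (with ★ `cmPrincipalSeries`'s own instance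
`locallyCompactSpace_cmBorelU L N v`), by `rfl` through ★ `principalSeries`.  Hence §1 applies VERBATIM to any `T : π →_G cmPrincipalSeries L N v χ` at `σ := (trivial ℂ T ℂ).twist χ`:
the retyping `(T : π.IntertwiningMap (normalizedInd (cmBorelTriple L N v) ((trivial ℂ T ℂ).twist χ)))` elaborates by `rfl` (cheap), whereas feeding such a `T` DIRECTLY to
`frobeniusEquiv (σ := …)` makes the elaborator unfold `smoothIndRep` (measured: `whnf` > 200 000 heartbeats) — so consumers should retype first, then use §1.
[cite: Rogawski1990, §12.2 p. 173] [cite: BernsteinZelevinsky1977, §1.8] -/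
theorem cmPrincipalSeries_eq_normalizedInd :
    cmPrincipalSeries L N v χ = (haveI := locallyCompactSpace_cmBorelU L N v;
      Representation.normalizedInd (cmBorelTriple L N v)
        ((Representation.trivial ℂ ↥(torusU (conjLocal L (IsCMField.complexConj L) v) (cmLocalForm L N v)) ℂ).twist χ)) :=
  rfl

end Character

/-! ## §3 (ED. 2) The inverse's naturality with NO `hψ`: the bundled `r_B(f)` of ★ `IntertwiningMapTransport` (E1 row 20, F0P3b-p01 (g24)) at the datum -/

section AnySigmaBundled

variable [LocallyCompactSpace ↥(borelU (conjLocal L (IsCMField.complexConj L) v) (cmLocalForm L N v))]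
  {V V' W : Type*} [AddCommGroup V] [Module ℂ V] [AddCommGroup V'] [Module ℂ V'] [AddCommGroup W] [Module ℂ W]
  {π : Representation ℂ ↥(unitaryGroupOfForm (conjLocal L (IsCMField.complexConj L) v) (cmLocalForm L N v)) V}
  {π' : Representation ℂ ↥(unitaryGroupOfForm (conjLocal L (IsCMField.complexConj L) v) (cmLocalForm L N v)) V'}
  (σ : Representation ℂ ↥(cmBorelTriple L N v).M W)

/-- **S7′ AT THE DATUM, hypothesis-free** («`adj⁻¹(ψ) ∘ f = adj⁻¹(ψ ∘ r_B f)`»): for `f : π′ → π` and `ψ : r_B π → σ` there IS a `T(L⁺_v)`-map `g : r_B π′ → r_B π` which is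
`jacquetMap (cmBorelTriple L N v) f` on underlying linear maps (★ `exists_normalizedJacquet_intertwiningMap`, row 20), and `E′⁻¹(ψ ∘ g) = E⁻¹(ψ) ∘ f` — §1 `frobeniusNormalized_cmBorel_symm_comp`
with its `hψ` discharged; ★ `exists_frobeniusNormalized_symm_comp` at `t := cmBorelTriple L N v`, `hδ` discharged. [cite: BernsteinZelevinsky1977, Proposition 1.9(b), p. 445] [cite: Casselman1995, §3.2] -/
theorem exists_frobeniusNormalized_cmBorel_symm_comp (hπ : π.IsSmooth) (hπ' : π'.IsSmooth) (f : π'.IntertwiningMap π)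
    (ψ : (π.normalizedJacquet (cmBorelTriple L N v)).IntertwiningMap σ) :
    ∃ g : (π'.normalizedJacquet (cmBorelTriple L N v)).IntertwiningMap (π.normalizedJacquet (cmBorelTriple L N v)),
      g.toLinearMap = (jacquetMap (cmBorelTriple L N v) f).toLinearMap ∧
      ((frobeniusEquiv (H := (cmBorelTriple L N v).P) (σ := Representation.twist (σ.comp (cmBorelTriple L N v).proj) (rootDeltaChar (cmBorelTriple L N v).P)) hπ').trans
          (normalizedJacquetHomEquiv (cmBorelTriple L N v) π' σ (deltaChar_cmBorelTriple_eq_one_of_mem_N L N v))).symm (ψ.comp g) =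
        (((frobeniusEquiv (H := (cmBorelTriple L N v).P) (σ := Representation.twist (σ.comp (cmBorelTriple L N v).proj) (rootDeltaChar (cmBorelTriple L N v).P)) hπ).trans
          (normalizedJacquetHomEquiv (cmBorelTriple L N v) π σ (deltaChar_cmBorelTriple_eq_one_of_mem_N L N v))).symm ψ).comp f :=
  exists_frobeniusNormalized_symm_comp (cmBorelTriple L N v) σ hπ hπ' (deltaChar_cmBorelTriple_eq_one_of_mem_N L N v) f ψ

end AnySigmaBundled

end Summit.HodgeConjecture.HodgeConjecture.Cruxes.H413.F0P3cStCharTSFrobeniusNaturality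

end
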